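import Summits.QuantumFields.BalabanUV.Beta.StencilExpSums

/-!
# Beta / ResolventCoeffAtomic — THE COEFFICIENT HYPOTHESIS FROM ATOMIC NORM TABLES: the two finite coefficient-norm sums `hP`, `hE` of the
# order-m leaf (`box_certificate_taylor_ofCoeffs`, p233050) REDUCED to per-index ATOMIC norm facts — `‖Z_β‖ ≤ zF_β` (β ∈ T_P) and
# `‖residualCoeff γ‖ ≤ Ē_γ` for the LOW multi-indices `|γ| ≤ N₀` only — with the `‖taylorCoeff κ‖` bounds, the whole HIGH part `|γ| > N₀` and
# both weighted sums decided IN THE KERNEL (β sub-cell, BINDER-OWNERS row CAP-k, lineage `b2b-balaban-beta-an5`, gen 29; node BETA-an5-g29-FIRSTLEAF,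
# item «COEFFHYP-ATOMIC»; cap4-g21 SIZE ANSWER l.23850 «hP-LITE ∕ hE-LITE», an5 ANSWER l.23894)

WHY.  After `FirstLeafK0` (cap-ref #100 R100-a-2: first certified leaf «modulo CoeffHyp ×16») the program-side input of a coefficient-currency leaf
is `CoeffHyp` = TWO AGGREGATE sums of norms of explicit matrices; a typed witness `Ẑ` is infeasible (1.5·10⁷ literals per sub-leaf, cap4-g21).  Here the
residue shrinks to ATOMIC facts — per β `zF_β ≥ ‖Z_β‖`, per LOW γ (`|γ| ≤ N₀`, where cancellation matters) `Ē_γ ≥ ‖residualCoeff γ‖` — and the kernel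
proves: §1 a duplicate-free LIST enumeration `degLTList` of the multi-indices (`degLTList_toFinset`, `nodup_degLTList`); §2 `‖taylorCoeff κ‖ ≤ esum
(coeffTerms κ L ν cIm)` (ONE `checkUB` per κ per sign class); §3 for `γ ≠ 0`, `‖residualCoeff γ‖ ≤ Σ_{β+κ=γ} ‖Z_β‖·‖taylorCoeff κ‖` and the split bound
`Σ_γ h^γ‖residualCoeff γ‖ ≤ Σ_{|γ|≤N₀} h^γ Ē_γ + Σ_{β,κ:|β+κ|>N₀} h^β zF_β·h^κ Tn_κ` (`sum_residualCoeff_le_atomic`); the sequel `ResolventCoeffAtomicSums`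
(§4–§5) turns the tables into association lists in canonical key order with every sum a list fold, and proves the END `coeff_sums_of_atomic` = the literal
`hP ∧ hE` pair of `certifies_ofCoeffs`.

HONEST FRAMING.  Kernel glue ([folklore]: submultiplicativity of the operator norm, triangle inequality, multinomial bookkeeping); no table, no number,
no box supplied; it changes the GRANULARITY of the program-side qualifier of a certified leaf (atomic norm facts instead of two aggregate sums), not its
nature — norms of explicit matrices stay outside the kernel.  0 binders of the real row instantiated; 0 certified coefficients; discharging `BetaPertH`
would make Bałaban's ultraviolet stability UNCONDITIONAL — NOT the continuum limit, NOT the Clay problem.  HONEST DEPENDENCY: continuum YM on T⁴ ⇐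
BetaPertH ∧ nine spine estimates (0∕9 proved); BetaPertH ⇐ (D1) ∧ (D4) ∧ CAP+tail; G-an2-4 gates asym, D1 and NE2∕3∕4.  0 `sorry`, 0 cite tags.
-/

namespace Summit.QuantumFields.BalabanUV.Beta.ResolventBoxCertificate

open Complex Set Matrix Finset
open Summit.QuantumFields.BalabanUV.Beta.PolyRegularAlgebra (character)
open Summit.QuantumFields.BalabanUV.Beta.StencilExpSums
open Literature.Analysis.ValidatedNumerics.ExpSum (ETerm esum checkUB esum_le_of_checkUB)
open scoped Real Matrix.Norms.L2Operator Pointwise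

noncomputable section

variable {d : ℕ} {n : Type*} [Fintype n] [DecidableEq n]

/-! ## §1 A list enumeration of the bounded multi-indices -/

/-- all functions `Fin k → ℕ` with values `< m`, as a LIST (structural in `k`). [folklore] -/
def bfuns : (k m : ℕ) → List (Fin k → ℕ)
  | 0, _ => [fun i => i.elim0]
  | k + 1, m => (List.range m).flatMap fun a => (bfuns k m).map fun f => (Fin.cons a f : Fin (k + 1) → ℕ)

/-- membership: `f ∈ bfuns k m ↔ ∀ i, f i < m`. [folklore] -/
theorem mem_bfuns : ∀ {k m : ℕ} {f : Fin k → ℕ}, f ∈ bfuns k m ↔ ∀ i, f i < m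
  | 0, m, f => by
    constructor
    · intro _ i; exact i.elim0
    · intro _
      have hf : f = fun i => i.elim0 := funext fun i => i.elim0
      rw [hf, bfuns]; exact List.mem_singleton.mpr rfl
  | k + 1, m, f => by
    rw [bfuns, List.mem_flatMap]
    constructor
    · rintro ⟨a, ha, hf⟩
      rw [List.mem_map] at hf
      obtain ⟨g, hg, rfl⟩ := hf
      rw [List.mem_range] at ha
      refine Fin.cases ?_ (fun i => ?_)
      · simpa using ha
      · simpa using (mem_bfuns.mp hg) i
    · intro hf
      refine ⟨f 0, List.mem_range.mpr (hf 0), ?_⟩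
      rw [List.mem_map]
      exact ⟨Fin.tail f, mem_bfuns.mpr fun i => hf i.succ, Fin.cons_self_tail f⟩

/-- **THE MULTI-INDICES OF TOTAL DEGREE `< m` AS A LIST** (canonical order). [folklore] -/
def degLTList (d m : ℕ) : List (Fin (d + 1) → ℕ) := (bfuns (d + 1) m).filter fun κ => decide (∑ μ, κ μ < m)

/-- the enumeration has no duplicates. [folklore] -/
theorem nodup_bfuns : ∀ (k m : ℕ), (bfuns k m).Nodup
  | 0, _ => List.nodup_singleton _
  | k + 1, m => by
    rw [bfuns, List.nodup_flatMap]
    constructor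
    · intro a _
      exact (nodup_bfuns k m).map fun f g hfg => by
        funext i
        have h1 := congrFun hfg i.succ
        simpa only [Fin.cons_succ] using h1
    · refine (List.nodup_range (n := m)).pairwise_of_forall_ne fun a _ b _ hab => ?_
      intro f hfa hfb
      rw [List.mem_map] at hfa hfb
      obtain ⟨g, _, rfl⟩ := hfa
      obtain ⟨g', _, hgg⟩ := hfb
      have h0 := congrFun hgg 0
      simp only [Fin.cons_zero] at h0
      exact hab h0.symm

/-- `degLTList` has no duplicates. [folklore] -/
theorem nodup_degLTList (d m : ℕ) : (degLTList d m).Nodup := (nodup_bfuns (d + 1) m).filter _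

variable [DecidableEq (Fin (d + 1) → ℕ)]

omit [DecidableEq (Fin (d + 1) → ℕ)] in
/-- membership in the list = membership in `degLT`. [folklore] -/
theorem mem_degLTList {m : ℕ} {κ : Fin (d + 1) → ℕ} : κ ∈ degLTList d m ↔ ∑ μ, κ μ < m := by
  rw [degLTList, List.mem_filter, mem_bfuns, decide_eq_true_eq]
  constructor
  · exact fun h => h.2
  · intro h
    refine ⟨fun i => lt_of_le_of_lt ?_ h, h⟩
    exact Finset.single_le_sum (fun j _ => Nat.zero_le (κ j)) (Finset.mem_univ i)

/-- **`(degLTList d m).toFinset = degLT d m`**. [folklore] -/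
theorem degLTList_toFinset (m : ℕ) : (degLTList d m).toFinset = degLT d m := by
  ext κ
  rw [List.mem_toFinset, mem_degLTList, mem_degLT]

/-- a sum of non-negative terms over `degLT` is at most the list sum over `degLTList`. [folklore] -/
theorem sum_degLT_le_listSum (m : ℕ) (f : (Fin (d + 1) → ℕ) → ℝ) (hf : ∀ κ ∈ degLTList d m, 0 ≤ f κ) :
    ∑ κ ∈ degLT d m, f κ ≤ ((degLTList d m).map f).sum := by
  rw [← degLTList_toFinset]; exact sum_toFinset_le_sum_map _ f hf

/-! ## §2 The norm of a Taylor coefficient as an exponential sum -/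

/-- `‖charWeight x κ‖` as a rational: `Π_μ |x_μ|^{κ_μ} ∕ κ_μ!`. [folklore] -/
def cwAbsQ (x : Fin (d + 1) → ℤ) (κ : Fin (d + 1) → ℕ) : ℚ := ∏ μ, |(x μ : ℚ)| ^ κ μ / ((κ μ).factorial : ℚ)

omit [DecidableEq (Fin (d + 1) → ℕ)] in
/-- the norm of the multi-index weight. [folklore] -/
theorem norm_charWeight (x : Fin (d + 1) → ℤ) (κ : Fin (d + 1) → ℕ) : ‖charWeight x κ‖ = ((cwAbsQ x κ : ℚ) : ℝ) := by
  rw [charWeight, cwAbsQ, norm_prod, Rat.cast_prod]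
  refine Finset.prod_congr rfl fun μ _ => ?_
  rw [norm_div, norm_pow, norm_mul, Complex.norm_I, one_mul, Complex.norm_intCast, Complex.norm_natCast]
  push_cast
  rfl

/-- THE TERM LIST of `‖taylorCoeff κ‖`: for each offset `x` the term `ν_x · |charWeight x κ| · e^{−Σ_μ x_μ cIm_μ}`. [folklore] -/
def coeffTerms (κ : Fin (d + 1) → ℕ) (L : List (Fin (d + 1) → ℤ)) (ν : (Fin (d + 1) → ℤ) → ℚ) (cIm : Fin (d + 1) → ℚ) : List ETerm :=
  L.map fun x => ratTerm (ν x * cwAbsQ x κ) (-dotQ x cIm)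

omit [DecidableEq (Fin (d + 1) → ℕ)] in
/-- **THE NORM OF A TAYLOR COEFFICIENT IS BOUNDED BY THE EXPONENTIAL SUM OF ITS TERM LIST** (offsets as a list with `L.toFinset = S`, rational
table-norm bounds `‖K x‖ ≤ ν x`, rational imaginary parts of the centre). [folklore] -/
theorem norm_taylorCoeff_le_esum {L : List (Fin (d + 1) → ℤ)} {S : Finset (Fin (d + 1) → ℤ)} (hLS : L.toFinset = S)
    {K : (Fin (d + 1) → ℤ) → Matrix n n ℂ} {ν : (Fin (d + 1) → ℤ) → ℚ} (hν : ∀ x ∈ S, ‖K x‖ ≤ ν x)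
    {c : Fin (d + 1) → ℂ} {cIm : Fin (d + 1) → ℚ} (hc : ∀ μ, (c μ).im = ((cIm μ : ℚ) : ℝ)) (κ : Fin (d + 1) → ℕ) :
    ‖taylorCoeff S K c κ‖ ≤ esum (coeffTerms κ L ν cIm) := by
  rw [coeffTerms, esum_map_ratTerm, taylorCoeff, ← hLS]
  have hterm : ∀ x ∈ L, ‖(character x c * charWeight x κ) • K x‖
      ≤ ((ν x * cwAbsQ x κ : ℚ) : ℝ) * Real.exp (((-dotQ x cIm : ℚ) : ℝ)) := by
    intro x hx
    have hxS : x ∈ S := by rw [← hLS, List.mem_toFinset]; exact hx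
    refine (norm_smul_le _ _).trans ?_
    rw [norm_mul, norm_character_eq, norm_charWeight]
    have e2 : (-∑ μ, (x μ : ℝ) * (c μ).im) = ((-dotQ x cIm : ℚ) : ℝ) := by
      rw [Rat.cast_neg, cast_dotQ]; exact congrArg Neg.neg (Finset.sum_congr rfl fun μ _ => by rw [hc])
    rw [e2, Rat.cast_mul]
    have hcw : (0 : ℝ) ≤ ((cwAbsQ x κ : ℚ) : ℝ) := by rw [← norm_charWeight]; exact norm_nonneg _
    calc Real.exp (((-dotQ x cIm : ℚ) : ℝ)) * ((cwAbsQ x κ : ℚ) : ℝ) * ‖K x‖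
        ≤ Real.exp (((-dotQ x cIm : ℚ) : ℝ)) * ((cwAbsQ x κ : ℚ) : ℝ) * ν x :=
          mul_le_mul_of_nonneg_left (hν x hxS) (mul_nonneg (Real.exp_pos _).le hcw)
      _ = ((ν x : ℚ) : ℝ) * ((cwAbsQ x κ : ℚ) : ℝ) * Real.exp (((-dotQ x cIm : ℚ) : ℝ)) := by ring
  refine (norm_sum_le _ _).trans ?_
  exact (sum_toFinset_le_sum_map L _ fun x _ => norm_nonneg _).trans (List.sum_le_sum fun x hx => hterm x hx)

omit [DecidableEq (Fin (d + 1) → ℕ)] in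
/-- **… FROM ONE KERNEL CHECK**: `checkUB Sc Kt kt (coeffTerms κ L ν cIm) T.num T.den = true ⟹ ‖taylorCoeff S K c κ‖ ≤ T`. [folklore] -/
theorem norm_taylorCoeff_le_of_checkUB {L : List (Fin (d + 1) → ℤ)} {S : Finset (Fin (d + 1) → ℤ)} (hLS : L.toFinset = S)
    {K : (Fin (d + 1) → ℤ) → Matrix n n ℂ} {ν : (Fin (d + 1) → ℤ) → ℚ} (hν : ∀ x ∈ S, ‖K x‖ ≤ ν x)
    {c : Fin (d + 1) → ℂ} {cIm : Fin (d + 1) → ℚ} (hc : ∀ μ, (c μ).im = ((cIm μ : ℚ) : ℝ)) (κ : Fin (d + 1) → ℕ)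
    {Sc Kt kt : ℕ} (hSc : 0 < Sc) {T : ℚ} (hcheck : checkUB Sc Kt kt (coeffTerms κ L ν cIm) T.num T.den = true) :
    ‖taylorCoeff S K c κ‖ ≤ (T : ℝ) :=
  (norm_taylorCoeff_le_esum hLS hν hc κ).trans (esum_le_rat_of_checkUB hSc hcheck)

/-! ## §3 The residual coefficient: atomic low part + submultiplicative high part -/

/-- the norm of a convolved coefficient: `‖Σ_{β+κ=γ} C₁ β · C₂ κ‖ ≤ Σ_{β+κ=γ} ‖C₁ β‖·‖C₂ κ‖`. [folklore] -/
theorem norm_convCoeff_le (T₁ T₂ : Finset (Fin (d + 1) → ℕ)) (C₁ C₂ : (Fin (d + 1) → ℕ) → Matrix n n ℂ) (γ : Fin (d + 1) → ℕ) :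
    ‖convCoeff T₁ T₂ C₁ C₂ γ‖ ≤ ∑ β ∈ T₁, ∑ κ ∈ T₂, if β + κ = γ then ‖C₁ β‖ * ‖C₂ κ‖ else 0 := by
  unfold convCoeff
  refine (norm_sum_le _ _).trans (Finset.sum_le_sum fun β _ => (norm_sum_le _ _).trans (Finset.sum_le_sum fun κ _ => ?_))
  split_ifs
  · exact l2_opNorm_mul _ _
  · simp

/-- **THE HIGH RESIDUAL COEFFICIENTS BY SUBMULTIPLICATIVITY**: for `γ ≠ 0`,
`‖residualCoeff T_P Z m S K c γ‖ ≤ Σ_{β∈T_P} Σ_{κ∈degLT d m} [β+κ=γ] ‖Z β‖·‖taylorCoeff S K c κ‖`. [folklore] -/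
theorem norm_residualCoeff_le_of_ne_zero (T_P : Finset (Fin (d + 1) → ℕ)) (Z : (Fin (d + 1) → ℕ) → Matrix n n ℂ) (m : ℕ)
    (S : Finset (Fin (d + 1) → ℤ)) (K : (Fin (d + 1) → ℤ) → Matrix n n ℂ) (c : Fin (d + 1) → ℂ) {γ : Fin (d + 1) → ℕ} (hγ : γ ≠ 0) :
    ‖residualCoeff T_P Z m S K c γ‖ ≤ ∑ β ∈ T_P, ∑ κ ∈ degLT d m, if β + κ = γ then ‖Z β‖ * ‖taylorCoeff S K c κ‖ else 0 := by
  rw [residualCoeff, if_neg hγ, zero_sub, norm_neg]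
  exact norm_convCoeff_le _ _ _ _ _

/-- **THE WEIGHTED RESIDUAL SUM FROM ATOMIC DATA**: LOW multi-indices (`Σ_μ γ_μ ≤ N₀`) by atomic bounds `Ē_γ`, HIGH ones by
`zF_β ≥ ‖Z_β‖`, `Tn_κ ≥ ‖taylorCoeff κ‖` and `h^{β+κ} = h^β h^κ`:
`Σ_{γ ∈ G} h^γ‖residualCoeff γ‖ ≤ Σ_{γ ∈ G, |γ| ≤ N₀} h^γ Ē_γ + Σ_{β∈T_P} Σ_{κ∈D} [|β+κ| > N₀] h^β zF_β · h^κ Tn_κ`, `G = insert 0 (T_P + D)`, `D = degLT d m`. [folklore] -/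
theorem sum_residualCoeff_le_atomic (T_P : Finset (Fin (d + 1) → ℕ)) (Z : (Fin (d + 1) → ℕ) → Matrix n n ℂ) (m : ℕ)
    (S : Finset (Fin (d + 1) → ℤ)) (K : (Fin (d + 1) → ℤ) → Matrix n n ℂ) (c : Fin (d + 1) → ℂ) {h : Fin (d + 1) → ℝ} (hh : ∀ μ, 0 ≤ h μ)
    (N₀ : ℕ) (Ebar zF Tn : (Fin (d + 1) → ℕ) → ℝ)
    (hE : ∀ γ ∈ insert 0 (T_P + degLT d m), ∑ μ, γ μ ≤ N₀ → ‖residualCoeff T_P Z m S K c γ‖ ≤ Ebar γ)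
    (hZ : ∀ β ∈ T_P, ‖Z β‖ ≤ zF β) (hTn : ∀ κ ∈ degLT d m, ‖taylorCoeff S K c κ‖ ≤ Tn κ) :
    ∑ γ ∈ insert 0 (T_P + degLT d m), monomial γ h * ‖residualCoeff T_P Z m S K c γ‖
      ≤ (∑ γ ∈ (insert 0 (T_P + degLT d m)).filter (fun γ => ∑ μ, γ μ ≤ N₀), monomial γ h * Ebar γ)
        + ∑ β ∈ T_P, ∑ κ ∈ degLT d m, if ∑ μ, (β + κ) μ ≤ N₀ then 0 else monomial β h * zF β * (monomial κ h * Tn κ) := by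
  set G := insert 0 (T_P + degLT d m) with hG
  set rc := residualCoeff T_P Z m S K c with hrc
  rw [← Finset.sum_filter_add_sum_filter_not G (fun γ => ∑ μ, γ μ ≤ N₀)]
  refine add_le_add ?_ ?_
  · refine Finset.sum_le_sum fun γ hγ => ?_
    rw [Finset.mem_filter] at hγ
    exact mul_le_mul_of_nonneg_left (hE γ hγ.1 hγ.2) (monomial_nonneg γ hh)
  · -- the HIGH part
    have hzF0 : ∀ β ∈ T_P, 0 ≤ zF β := fun β hβ => (norm_nonneg _).trans (hZ β hβ)
    have hTn0 : ∀ κ ∈ degLT d m, 0 ≤ Tn κ := fun κ hκ => (norm_nonneg _).trans (hTn κ hκ)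
    -- step 1: termwise, for γ in the high filter (γ ≠ 0)
    have step1 : ∀ γ ∈ G.filter (fun γ => ¬ ∑ μ, γ μ ≤ N₀),
        monomial γ h * ‖rc γ‖ ≤ ∑ β ∈ T_P, ∑ κ ∈ degLT d m, if β + κ = γ then monomial γ h * (zF β * Tn κ) else 0 := by
      intro γ hγ
      rw [Finset.mem_filter] at hγ
      have hγ0 : γ ≠ 0 := by
        rintro rfl
        exact hγ.2 (by simp)
      have h1 := norm_residualCoeff_le_of_ne_zero T_P Z m S K c hγ0
      calc monomial γ h * ‖rc γ‖
          ≤ monomial γ h * ∑ β ∈ T_P, ∑ κ ∈ degLT d m, if β + κ = γ then ‖Z β‖ * ‖taylorCoeff S K c κ‖ else 0 :=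
            mul_le_mul_of_nonneg_left h1 (monomial_nonneg γ hh)
        _ = ∑ β ∈ T_P, ∑ κ ∈ degLT d m, if β + κ = γ then monomial γ h * (‖Z β‖ * ‖taylorCoeff S K c κ‖) else 0 := by
            rw [Finset.mul_sum]
            refine Finset.sum_congr rfl fun β _ => ?_
            rw [Finset.mul_sum]
            refine Finset.sum_congr rfl fun κ _ => ?_
            split_ifs <;> simp
        _ ≤ ∑ β ∈ T_P, ∑ κ ∈ degLT d m, if β + κ = γ then monomial γ h * (zF β * Tn κ) else 0 := by
            refine Finset.sum_le_sum fun β hβ => Finset.sum_le_sum fun κ hκ => ?_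
            split_ifs
            · exact mul_le_mul_of_nonneg_left (mul_le_mul (hZ β hβ) (hTn κ hκ) (norm_nonneg _) (hzF0 β hβ)) (monomial_nonneg γ hh)
            · exact le_rfl
    refine (Finset.sum_le_sum step1).trans ?_
    -- step 2: exchange the sums and evaluate the γ-sum
    rw [Finset.sum_comm]
    refine Finset.sum_le_sum fun β hβ => ?_
    rw [Finset.sum_comm]
    refine Finset.sum_le_sum fun κ hκ => ?_
    rw [Finset.sum_ite_eq]
    have hmem : β + κ ∈ G := by
      rw [hG]; exact Finset.mem_insert_of_mem (Finset.add_mem_add hβ hκ)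
    by_cases hlow : ∑ μ, (β + κ) μ ≤ N₀
    · rw [if_neg (by rw [Finset.mem_filter]; exact fun hc => hc.2 hlow), if_pos hlow]
    · rw [if_pos (Finset.mem_filter.mpr ⟨hmem, hlow⟩), if_neg hlow, monomial_add]
      have := monomial_nonneg β hh
      have := monomial_nonneg κ hh
      nlinarith [hzF0 β hβ, hTn0 κ hκ]

end

end Summit.QuantumFields.BalabanUV.Beta.ResolventBoxCertificate
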